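import Summits.SmoothPoincare4.SmoothPoincare4.Theses.EntropyRung
import Summits.SmoothPoincare4.SmoothPoincare4.Theorems.EntropyRungSubcylindricalExistenceGreenDataConformal
import Literature.Geometry.Riemannian.RoundSphereProofs
import Literature.Geometry.Riemannian.AubinYamabeSphereEuclidean
import HarnessLib

/-!
# Conformal covariance of Green data on `S⁴`: the Green function of `g = W² g_S` at `p` is `G_S/W`
(stub `helper_sphereGreenWarped`, witness helper 8 of line `green-blowup-conformal-entropy`,
crux `EntropyRung.SubcylindricalExistence`, item stmt-SmoothPoincare4-10871)

On Mathlib's unit sphere `S⁴ = Metric.sphere (0 : EuclideanSpace ℝ (Fin 5)) 1` with the round metric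
`g_S = roundMetric` let `g = W² g_S` for a smooth positive `W` (both metrics with their Levi-Civita
connections, `g` Riemannian), and let `G_S x = 2/(1 − ⟪x,p⟫)` be the round Green function of the
conformal Laplacian `L_S = R_S − 6 Δ_S` at `p` (its Green package — smooth and positive off `p`,
`R_S G_S − 6 Δ_S G_S = 0` off `p`, `G_S → +∞` at `p` — is a HYPOTHESIS here). Then

* `G := G_S/W` is the Green package of `L_g` at `p`: smooth and positive on `S⁴ ∖ {p}`,
  `R_g G − 6 Δ_g G = 0` there, and `G → +∞` at `p` — this is EXACTLY
  `GreenDataConformal.greenData_transport` (conformal invariance of the Green function of the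
  conformal Laplacian, Lee–Parker 1987, (2.7) and §6) applied with `g := g_S` (Riemannian by
  `isRiemannian_roundMetric`), `g' := g`, `φ := W`; `S⁴` is Hausdorff and compact (Mathlib);
* in the stereographic chart `φ = extChartAt (𝓡 4) p` at `p` (with `φ p = 0`, height
  `⟪φ⁻¹ y, p⟫ = (4 − ‖y‖²)/(4 + ‖y‖²)` and `W(φ⁻¹ y) = (4 + ‖y‖²)/4` on the closed chart ball —
  all HYPOTHESES here), `G(φ⁻¹ y) = 4/‖y − φ p‖² + 0` for `y ≠ φ p` in the ball: pure algebra,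
  `1 − ⟪φ⁻¹ y, p⟫ = 2‖y‖²/(4 + ‖y‖²)`, so `G_S = (4 + ‖y‖²)/‖y‖²` and `G = 4/‖y‖²`.

Everything is proved; no definition, no named fact.

References: J. M. Lee, T. H. Parker, *The Yamabe problem*, Bull. AMS 17 (1987) 37–91, (2.7) and §6
[LeeParker1987].
-/

noncomputable section

-- the registered namespace `Summit.SmoothPoincare4.SmoothPoincare4.Theorems` repeats a component
set_option linter.dupNamespace false

open scoped Manifold ContDiff Topology ENNReal NNReal ContinuousMap RealInnerProductSpace
open Set Filter MeasureTheory
open Literature.Geometry.Lorentzian Literature.Geometry.Riemannian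

namespace Summit.SmoothPoincare4.SmoothPoincare4.Theorems

/-- **Witness helper 8 — conformal covariance of Green data on `S⁴`** (registered stub
`helper_sphereGreenWarped` of line `green-blowup-conformal-entropy`). For `g = W² g_S` on Mathlib's
`S⁴` (smooth positive `W`, both metrics with Levi-Civita connections) and the round Green package of
`G_S x = 2/(1 − ⟪x,p⟫)` at `p` (hypothesis), `G := G_S/W` is smooth and positive off `p`, solves
`R_g G − 6 Δ_g G = 0` off `p` and tends to `+∞` at `p` (`GreenDataConformal.greenData_transport`
with `g := g_S`, `g' := g`, `φ := W`), and in the stereographic chart at `p`, where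
`⟪φ⁻¹ y, p⟫ = (4 − ‖y‖²)/(4 + ‖y‖²)` and `W(φ⁻¹ y) = (4 + ‖y‖²)/4` on the closed chart ball
(hypotheses), `G(φ⁻¹ y) = 4/‖y − φ p‖² + 0` for `y ≠ φ p = 0`. Lee–Parker 1987, (2.7) and §6
(conformal invariance of the Green function of the conformal Laplacian).
[cite: LeeParker1987, (2.7) and §6] -/
theorem helper_sphereGreenWarped :
    ∀ [Fact (Module.finrank ℝ (EuclideanSpace ℝ (Fin 5)) = 4 + 1)] (p : Metric.sphere (0 :
      EuclideanSpace ℝ (Fin 5)) 1) [(@roundMetric (EuclideanSpace ℝ (Fin 5)) _ _ 4 _).HasLeviCivita]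
      (g : PseudoRiemannianMetric (𝓡 4) ∞ (EuclideanSpace ℝ (Fin 4)) (TangentSpace (𝓡 4) :
      Metric.sphere (0 : EuclideanSpace ℝ (Fin 5)) 1 → Type _)) [g.HasLeviCivita], g.IsRiemannian →
      ∀ (W : Metric.sphere (0 : EuclideanSpace ℝ (Fin 5)) 1 → ℝ), ContMDiff (𝓡 4) 𝓘(ℝ, ℝ) ∞ W → (∀
      x, 0 < W x) → (∀ (x : Metric.sphere (0 : EuclideanSpace ℝ (Fin 5)) 1) (v w : TangentSpace (𝓡
      4) x), g.val x v w = W x ^ 2 * (@roundMetric (EuclideanSpace ℝ (Fin 5)) _ _ 4 _).val x v w) →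
      (ContMDiffOn (𝓡 4) 𝓘(ℝ, ℝ) ∞ (fun x : Metric.sphere (0 : EuclideanSpace ℝ (Fin 5)) 1 ↦ (2 / (1
      - ⟪(x : EuclideanSpace ℝ (Fin 5)), (p : EuclideanSpace ℝ (Fin 5))⟫))) {p}ᶜ ∧ (∀ x :
      Metric.sphere (0 : EuclideanSpace ℝ (Fin 5)) 1, x ≠ p → 0 < (2 / (1 - ⟪(x : EuclideanSpace ℝ
      (Fin 5)), (p : EuclideanSpace ℝ (Fin 5))⟫))) ∧ (∀ x : Metric.sphere (0 : EuclideanSpace ℝ (Fin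
      5)) 1, x ≠ p → (@roundMetric (EuclideanSpace ℝ (Fin 5)) _ _ 4 _).scalarCurvature x * (2 / (1 -
      ⟪(x : EuclideanSpace ℝ (Fin 5)), (p : EuclideanSpace ℝ (Fin 5))⟫)) - 6 * (@roundMetric
      (EuclideanSpace ℝ (Fin 5)) _ _ 4 _).dalembertian (fun x : Metric.sphere (0 : EuclideanSpace ℝ
      (Fin 5)) 1 ↦ (2 / (1 - ⟪(x : EuclideanSpace ℝ (Fin 5)), (p : EuclideanSpace ℝ (Fin 5))⟫))) x =
      0) ∧ Tendsto (fun x : Metric.sphere (0 : EuclideanSpace ℝ (Fin 5)) 1 ↦ (2 / (1 - ⟪(x :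
      EuclideanSpace ℝ (Fin 5)), (p : EuclideanSpace ℝ (Fin 5))⟫))) (𝓝[≠] p) atTop) → ∀ (r : ℝ), 0 <
      r → extChartAt (𝓡 4) p p = 0 → (∀ y : EuclideanSpace ℝ (Fin 4), ⟪(((extChartAt (𝓡 4) p).symm y
      : Metric.sphere (0 : EuclideanSpace ℝ (Fin 5)) 1) : EuclideanSpace ℝ (Fin 5)), (p :
      EuclideanSpace ℝ (Fin 5))⟫ = (4 - ‖y‖ ^ 2) / (4 + ‖y‖ ^ 2)) → (∀ y ∈ Metric.closedBall
      (extChartAt (𝓡 4) p p) r, W ((extChartAt (𝓡 4) p).symm y) = (4 + ‖y‖ ^ 2) / 4) → (ContMDiffOn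
      (𝓡 4) 𝓘(ℝ, ℝ) ∞ (fun x : Metric.sphere (0 : EuclideanSpace ℝ (Fin 5)) 1 ↦ (2 / (1 - ⟪(x :
      EuclideanSpace ℝ (Fin 5)), (p : EuclideanSpace ℝ (Fin 5))⟫)) / W x) {p}ᶜ ∧ (∀ x :
      Metric.sphere (0 : EuclideanSpace ℝ (Fin 5)) 1, x ≠ p → 0 < (2 / (1 - ⟪(x : EuclideanSpace ℝ
      (Fin 5)), (p : EuclideanSpace ℝ (Fin 5))⟫)) / W x) ∧ (∀ x : Metric.sphere (0 : EuclideanSpace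
      ℝ (Fin 5)) 1, x ≠ p → g.scalarCurvature x * ((2 / (1 - ⟪(x : EuclideanSpace ℝ (Fin 5)), (p :
      EuclideanSpace ℝ (Fin 5))⟫)) / W x) - 6 * g.dalembertian (fun x : Metric.sphere (0 :
      EuclideanSpace ℝ (Fin 5)) 1 ↦ (2 / (1 - ⟪(x : EuclideanSpace ℝ (Fin 5)), (p : EuclideanSpace ℝ
      (Fin 5))⟫)) / W x) x = 0) ∧ Tendsto (fun x : Metric.sphere (0 : EuclideanSpace ℝ (Fin 5)) 1 ↦
      (2 / (1 - ⟪(x : EuclideanSpace ℝ (Fin 5)), (p : EuclideanSpace ℝ (Fin 5))⟫)) / W x) (𝓝[≠] p)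
      atTop) ∧ (∀ y ∈ Metric.closedBall (extChartAt (𝓡 4) p p) r, y ≠ extChartAt (𝓡 4) p p → (2 / (1
      - ⟪(((extChartAt (𝓡 4) p).symm y) : EuclideanSpace ℝ (Fin 5)), (p : EuclideanSpace ℝ (Fin
      5))⟫)) / W ((extChartAt (𝓡 4) p).symm y) = 4 / ‖y - extChartAt (𝓡 4) p p‖ ^ 2 + 0) := by
  intro _ p _ g _ _ W hWs hWpos hgval hGS r _ hp0 hinner hWball
  refine ⟨GreenDataConformal.greenData_transport (@roundMetric (EuclideanSpace ℝ (Fin 5)) _ _ 4 _) g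
    isRiemannian_roundMetric hWs hWpos hgval hGS.1 hGS.2.1 hGS.2.2.1 hGS.2.2.2, fun y hy hy0 ↦ ?_⟩
  -- the chart formula: `G(φ⁻¹ y) = ((4 + ‖y‖²)/‖y‖²) / ((4 + ‖y‖²)/4) = 4/‖y‖²`
  rw [hWball y hy, hinner y]
  rw [hp0] at hy0
  rw [hp0, sub_zero, add_zero]
  have hn : ‖y‖ ≠ 0 := norm_ne_zero_iff.2 hy0
  have h4 : (4 : ℝ) + ‖y‖ ^ 2 ≠ 0 := by positivity
  field_simp
  ring

end Summit.SmoothPoincare4.SmoothPoincare4.Theorems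

end
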